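import Mathlib
import Summits.Ventures.PercRepro2.Defs
import Summits.Ventures.PercRepro2.Graph
import Summits.Ventures.PercRepro2.OneColourSwitch
import Summits.Ventures.PercRepro2.RegionHubSign
import Summits.Ventures.PercRepro2.SideSwitch
import Summits.Ventures.PercRepro2.M9NoPocketDefs
import Summits.Ventures.PercRepro2.M9PocketRSEdgeTransfer
import Summits.Ventures.PercRepro2.M9PocketRootOnlyTransfer

/-!
# A cluster hanging from `{r, s, p}` — paths from the marks (blind cell PercRepro2, p3 g41,
2026-08-29; `proofs/P3-POCKETRK.md` §10⁵ (j): the root-only calculus with the mark `p` as a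
third exit)

Let `L` be a vertex set (`p, q, r, s ∉ L`) every edge of which has its other endpoint in
`L ∪ {r, s, p}`, and `F` the edges inside `L ∪ {r, s, p}`.  Under `Sep` the mark `p` is joined
to neither `r` nor `s`, so in an admissible colouring of `F` (`p` not `F`-joined to `r`, `s` in
either colour) the cluster behaves exactly like a root-only cluster: a path of `G` from `p`
either stays in `G − F` or stays in the `F`-graph (`conn_restrict_or_F_of_conn_p`), hence `Sep`
transfers (`not_conn_p_mark_of_restrict`, `not_conn_q_mark_of_restrict`) and `σ_pq` is
unchanged (`conn_pq_restrict_iff_of_sep`).  The worlds are in `M9PocketRootOnlyPWorlds`.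
Own work; std axioms.
-/

namespace Summit.Ventures.PercRepro2

namespace NoPocket

open Finset Classical OneColourSwitch SideSwitch

variable {V : Type*} {E : Type*} {ends : E → Sym2 V} {p q r s d : V} {ω : Config E} {L : Set V}

section ClusterP

/-- An edge at a vertex of `L` lies inside `L ∪ {r, s, p}`. -/
lemma mem_within_of_mem_L_p
    (hL : ∀ e x y, ends e = s(x, y) → x ∈ L → y ∈ L ∨ y = r ∨ y = s ∨ y = p)
    {e : E} {a b : V} (hab : ends e = s(a, b)) (ha : a ∈ L) :
    e ∈ within ends (L ∪ {r, s, p} : Set V) := by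
  refine ⟨a, Or.inl ha, b, ?_, hab⟩
  rcases hL e a b hab ha with h | h | h | h
  · exact Or.inl h
  · exact Or.inr (by rw [h]; simp)
  · exact Or.inr (by rw [h]; simp)
  · exact Or.inr (by rw [h]; simp)

/-- An edge off `F` has no endpoint in `L`. -/
lemma notMem_L_of_notMem_within_p
    (hL : ∀ e x y, ends e = s(x, y) → x ∈ L → y ∈ L ∨ y = r ∨ y = s ∨ y = p)
    {e : E} (he : e ∉ within ends (L ∪ {r, s, p} : Set V)) {a b : V} (hab : ends e = s(a, b)) :
    a ∉ L ∧ b ∉ L := by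
  constructor
  · intro ha
    exact he (mem_within_of_mem_L_p hL hab ha)
  · intro hb
    exact he (mem_within_of_mem_L_p hL (by rw [hab, Sym2.eq_swap]) hb)

/-- A restricted path from a vertex off `L` never enters `L`. -/
lemma notMem_L_of_conn_restrict_p
    (hL : ∀ e x y, ends e = s(x, y) → x ∈ L → y ∈ L ∨ y = r ∨ y = s ∨ y = p) {x y : V}
    (hx : x ∉ L)
    (h : Conn (fun e : {e // e ∉ within ends (L ∪ {r, s, p} : Set V)} => ends e.1)
      (fun e => ω e.1) x y) : y ∉ L := by
  have key : y ∈ {z | z ∉ L} := by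
    refine mem_of_conn_of_closed (S := {z | z ∉ L}) ?_ hx h
    intro a _ b hab
    obtain ⟨_, e, _, hends⟩ := openGraph_adj.1 hab
    exact (notMem_L_of_notMem_within_p hL e.2 hends).2
  exact key

/-- A path of the `F`-graph from a vertex of `L ∪ {r, s, p}` stays in `L ∪ {r, s, p}`. -/
lemma mem_of_conn_F_p {x y : V} (hx : x ∈ (L ∪ {r, s, p} : Set V))
    (h : Conn (fun e : {e // ¬ (e ∉ within ends (L ∪ {r, s, p} : Set V))} => ends e.1)
      (fun e => ω e.1) x y) : y ∈ (L ∪ {r, s, p} : Set V) := by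
  refine mem_of_conn_of_closed (S := (L ∪ {r, s, p} : Set V)) ?_ hx h
  intro a _ b hab
  obtain ⟨_, e, _, hends⟩ := openGraph_adj.1 hab
  exact (mem_of_mem_within (not_not.1 e.2) hends).2

/-- **A path from `p` stays in one of the two graphs** when `p` is joined to neither `r` nor
`s` in either of them. -/
lemma conn_restrict_or_F_of_conn_p
    (hL : ∀ e x y, ends e = s(x, y) → x ∈ L → y ∈ L ∨ y = r ∨ y = s ∨ y = p) (hp : p ∉ L)
    (h1 : ¬ Conn (fun e : {e // e ∉ within ends (L ∪ {r, s, p} : Set V)} => ends e.1)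
      (fun e => ω e.1) p r)
    (h2 : ¬ Conn (fun e : {e // e ∉ within ends (L ∪ {r, s, p} : Set V)} => ends e.1)
      (fun e => ω e.1) p s)
    (h3 : ¬ Conn (fun e : {e // ¬ (e ∉ within ends (L ∪ {r, s, p} : Set V))} => ends e.1)
      (fun e => ω e.1) p r)
    (h4 : ¬ Conn (fun e : {e // ¬ (e ∉ within ends (L ∪ {r, s, p} : Set V))} => ends e.1)
      (fun e => ω e.1) p s)
    {y : V} (h : Conn ends ω p y) :
    Conn (fun e : {e // e ∉ within ends (L ∪ {r, s, p} : Set V)} => ends e.1) (fun e => ω e.1)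
      p y ∨
    Conn (fun e : {e // ¬ (e ∉ within ends (L ∪ {r, s, p} : Set V))} => ends e.1)
      (fun e => ω e.1) p y := by
  refine mem_of_conn_of_closed (S := {z |
    Conn (fun e : {e // e ∉ within ends (L ∪ {r, s, p} : Set V)} => ends e.1) (fun e => ω e.1)
      p z ∨
    Conn (fun e : {e // ¬ (e ∉ within ends (L ∪ {r, s, p} : Set V))} => ends e.1)
      (fun e => ω e.1) p z}) ?_ (Or.inl (conn_refl _ _ _)) h
  intro a ha b hab
  simp only [Set.mem_setOf_eq] at ha ⊢
  obtain ⟨_, e, he, hends⟩ := openGraph_adj.1 hab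
  by_cases hP : e ∈ within ends (L ∪ {r, s, p} : Set V)
  · have hadj : Conn (fun e : {e // ¬ (e ∉ within ends (L ∪ {r, s, p} : Set V))} => ends e.1)
        (fun e => ω e.1) a b :=
      conn_of_openAdj ⟨⟨e, not_not.2 hP⟩, he, hends⟩
    rcases ha with ha | ha
    · -- `a` on a restricted path from `p`: `a ∈ {r, s, p}`
      have haL : a ∉ L := notMem_L_of_conn_restrict_p hL hp ha
      obtain ⟨ha', _⟩ := mem_of_mem_within hP hends
      simp only [Set.mem_union, Set.mem_insert_iff, Set.mem_singleton_iff] at ha'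
      rcases ha' with ha' | rfl | rfl | rfl
      · exact (haL ha').elim
      · exact (h1 ha).elim
      · exact (h2 ha).elim
      · exact Or.inr hadj
    · exact Or.inr (conn_trans ha hadj)
  · have hadj : Conn (fun e : {e // e ∉ within ends (L ∪ {r, s, p} : Set V)} => ends e.1)
        (fun e => ω e.1) a b :=
      conn_of_openAdj ⟨⟨e, hP⟩, he, hends⟩
    rcases ha with ha | ha
    · exact Or.inl (conn_trans ha hadj)
    · -- `a` on an `F`-path from `p`: `a ∈ {r, s, p}` (not in `L`)
      have haL : a ∉ L := (notMem_L_of_notMem_within_p hL hP hends).1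
      have ha' := mem_of_conn_F_p (by simp) ha
      simp only [Set.mem_union, Set.mem_insert_iff, Set.mem_singleton_iff] at ha'
      rcases ha' with ha' | rfl | rfl | rfl
      · exact (haL ha').elim
      · exact (h3 ha).elim
      · exact (h4 ha).elim
      · exact Or.inl hadj

/-- **`p` is not joined to `t ∈ {r, s}` in `G`** when it is joined to neither `r` nor `s` in the
restriction or in the `F`-graph. -/
lemma not_conn_p_mark_of_restrict
    (hL : ∀ e x y, ends e = s(x, y) → x ∈ L → y ∈ L ∨ y = r ∨ y = s ∨ y = p) (hp : p ∉ L)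
    {t : V} (ht : t = r ∨ t = s)
    (h1 : ¬ Conn (fun e : {e // e ∉ within ends (L ∪ {r, s, p} : Set V)} => ends e.1)
      (fun e => ω e.1) p r)
    (h2 : ¬ Conn (fun e : {e // e ∉ within ends (L ∪ {r, s, p} : Set V)} => ends e.1)
      (fun e => ω e.1) p s)
    (h3 : ¬ Conn (fun e : {e // ¬ (e ∉ within ends (L ∪ {r, s, p} : Set V))} => ends e.1)
      (fun e => ω e.1) p r)
    (h4 : ¬ Conn (fun e : {e // ¬ (e ∉ within ends (L ∪ {r, s, p} : Set V))} => ends e.1)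
      (fun e => ω e.1) p s) :
    ¬ Conn ends ω p t := by
  intro hc
  rcases conn_restrict_or_F_of_conn_p hL hp h1 h2 h3 h4 hc with h | h
  · exact ht.elim (fun e => h1 (e ▸ h)) (fun e => h2 (e ▸ h))
  · exact ht.elim (fun e => h3 (e ▸ h)) (fun e => h4 (e ▸ h))

/-- **`q` is not joined to `t ∈ {r, s}` in `G`**: a path from `q` enters the cluster only
through `p`, and `p` is not `F`-joined to `r`, `s`. -/
lemma not_conn_q_mark_of_restrict
    (hL : ∀ e x y, ends e = s(x, y) → x ∈ L → y ∈ L ∨ y = r ∨ y = s ∨ y = p) (hq : q ∉ L)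
    {t : V} (ht : t = r ∨ t = s)
    (h1 : ¬ Conn (fun e : {e // e ∉ within ends (L ∪ {r, s, p} : Set V)} => ends e.1)
      (fun e => ω e.1) q r)
    (h2 : ¬ Conn (fun e : {e // e ∉ within ends (L ∪ {r, s, p} : Set V)} => ends e.1)
      (fun e => ω e.1) q s)
    (h3 : ¬ Conn (fun e : {e // ¬ (e ∉ within ends (L ∪ {r, s, p} : Set V))} => ends e.1)
      (fun e => ω e.1) p r)
    (h4 : ¬ Conn (fun e : {e // ¬ (e ∉ within ends (L ∪ {r, s, p} : Set V))} => ends e.1)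
      (fun e => ω e.1) p s) :
    ¬ Conn ends ω q t := by
  intro hc
  have key : t ∈ {z |
      Conn (fun e : {e // e ∉ within ends (L ∪ {r, s, p} : Set V)} => ends e.1) (fun e => ω e.1)
        q z ∨
      (Conn (fun e : {e // e ∉ within ends (L ∪ {r, s, p} : Set V)} => ends e.1)
        (fun e => ω e.1) q p ∧
      Conn (fun e : {e // ¬ (e ∉ within ends (L ∪ {r, s, p} : Set V))} => ends e.1)
        (fun e => ω e.1) p z)} := by
    refine mem_of_conn_of_closed ?_ (Or.inl (conn_refl _ _ _)) hc
    intro a ha b hab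
    simp only [Set.mem_setOf_eq] at ha ⊢
    obtain ⟨_, e, he, hends⟩ := openGraph_adj.1 hab
    by_cases hP : e ∈ within ends (L ∪ {r, s, p} : Set V)
    · have hadj : Conn (fun e : {e // ¬ (e ∉ within ends (L ∪ {r, s, p} : Set V))} => ends e.1)
          (fun e => ω e.1) a b :=
        conn_of_openAdj ⟨⟨e, not_not.2 hP⟩, he, hends⟩
      rcases ha with ha | ⟨hqp, ha⟩
      · have haL : a ∉ L := notMem_L_of_conn_restrict_p hL hq ha
        obtain ⟨ha', _⟩ := mem_of_mem_within hP hends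
        simp only [Set.mem_union, Set.mem_insert_iff, Set.mem_singleton_iff] at ha'
        rcases ha' with ha' | rfl | rfl | rfl
        · exact (haL ha').elim
        · exact (h1 ha).elim
        · exact (h2 ha).elim
        · exact Or.inr ⟨ha, hadj⟩
      · exact Or.inr ⟨hqp, conn_trans ha hadj⟩
    · have hadj : Conn (fun e : {e // e ∉ within ends (L ∪ {r, s, p} : Set V)} => ends e.1)
          (fun e => ω e.1) a b :=
        conn_of_openAdj ⟨⟨e, hP⟩, he, hends⟩
      rcases ha with ha | ⟨hqp, ha⟩
      · exact Or.inl (conn_trans ha hadj)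
      · have haL : a ∉ L := (notMem_L_of_notMem_within_p hL hP hends).1
        have ha' := mem_of_conn_F_p (by simp) ha
        simp only [Set.mem_union, Set.mem_insert_iff, Set.mem_singleton_iff] at ha'
        rcases ha' with ha' | rfl | rfl | rfl
        · exact (haL ha').elim
        · exact (h3 ha).elim
        · exact (h4 ha).elim
        · exact Or.inl (conn_trans hqp hadj)
  simp only [Set.mem_setOf_eq] at key
  rcases key with h | ⟨_, h⟩
  · exact ht.elim (fun e => h1 (e ▸ h)) (fun e => h2 (e ▸ h))
  · exact ht.elim (fun e => h3 (e ▸ h)) (fun e => h4 (e ▸ h))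

/-- **`p ~_Y q` in `G` iff in the restriction**, at a `Sep` point with admissible `F`-colouring. -/
lemma conn_pq_restrict_iff_of_sep
    (hL : ∀ e x y, ends e = s(x, y) → x ∈ L → y ∈ L ∨ y = r ∨ y = s ∨ y = p) (hp : p ∉ L)
    (hq : q ∉ L)
    (h1 : ¬ Conn (fun e : {e // e ∉ within ends (L ∪ {r, s, p} : Set V)} => ends e.1)
      (fun e => ω e.1) p r)
    (h2 : ¬ Conn (fun e : {e // e ∉ within ends (L ∪ {r, s, p} : Set V)} => ends e.1)
      (fun e => ω e.1) p s)
    (h3 : ¬ Conn (fun e : {e // ¬ (e ∉ within ends (L ∪ {r, s, p} : Set V))} => ends e.1)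
      (fun e => ω e.1) p r)
    (h4 : ¬ Conn (fun e : {e // ¬ (e ∉ within ends (L ∪ {r, s, p} : Set V))} => ends e.1)
      (fun e => ω e.1) p s) :
    Conn ends ω p q ↔
      Conn (fun e : {e // e ∉ within ends (L ∪ {r, s, p} : Set V)} => ends e.1) (fun e => ω e.1)
        p q := by
  refine ⟨fun h => ?_, conn_of_conn_restrict⟩
  rcases conn_restrict_or_F_of_conn_p hL hp h1 h2 h3 h4 h with h' | h'
  · exact h'
  · -- an `F`-path from `p` to `q ∉ L` ends at `r`, `s` (excluded) or at `p` itself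
    have hq' := mem_of_conn_F_p (by simp) h'
    simp only [Set.mem_union, Set.mem_insert_iff, Set.mem_singleton_iff] at hq'
    rcases hq' with hq' | rfl | rfl | rfl
    · exact (hq hq').elim
    · exact (h3 h').elim
    · exact (h4 h').elim
    · exact conn_refl _ _ _

end ClusterP

end NoPocket

end Summit.Ventures.PercRepro2
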